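import Literature.Geometry.Lorentzian.TeukolskyWhitingTransform
import Literature.Geometry.Lorentzian.TeukolskyOutgoingExpansion
import Literature.Geometry.Lorentzian.TeukolskyHorizonVanishing
import HarnessLib

/-!
# The transformed function solves the tilde equation off the real axis
# (Teixeira da Costa 2020, Lemma 3.12 for `y ω > 0`)

Sixth file of the proof programme for the named fact
`Literature.Geometry.Lorentzian.Kerr.Costa2019_realAxisModeStability` (R. Teixeira da Costa,
Commun. Math. Phys. 378 (2020) 705–781 = arXiv:1910.02854 [Costa2019], Thm. 4.1). For a
classical solution `R` of the radial Teukolsky equation (`s ≤ 0`) which is outgoing at the horizon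
and at infinity, the amplitude `Φ = (r−r₋)^η (r−r₊)^ξ e^{γr} R` (`Costa2019.whitingAmplitude`,
`|Φ| = |R|`) has Whiting transforms `G_j(z) = ∫_{r₊}^∞ e^{A(z−r₋)(r−r₋)} (A(r−r₋))ʲ Φ(r) dr`
(`j = 0, 1, 2`, absolutely convergent for `y ω > 0`, `z = x + iy`), and these satisfy the
confluent-Heun-type "tilde" equation in `z`:
`(z − r₊)(z − r₋) G₂ + P̃(z) G₁ + Q̃(z) G₀ = 0` (`Costa2019.whitingTransform_tildeEquation`).
Proof as printed (Lemma 3.12): the kernel intertwines `𝒯_r` and `𝒯̃_z`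
(`Costa2019.heunOp_whitingKernel`), `𝒯_r` is symmetric for the weight `w`
(`Costa2019.lagrange_identity_heun`), and the boundary terms `w Δ (K g' − g K')` vanish at
`r → r₊⁺` ("the extra factor of `(r − r₊)`", boundary conditions of `g`) and at `r → ∞`
(exponential decay of the kernel for `y ω > 0` against the polynomial growth of `g`, `g'`).
Everything is proved; no named facts.

## References
* R. Teixeira da Costa, CMP 378 (2020) 705–781, arXiv:1910.02854, §3.2.2, Lemma 3.12, Lemma 3.13.
  [Costa2019]
-/

noncomputable section

open Complex Set MeasureTheory Filter Topology

namespace Literature.Geometry.Lorentzian.Kerr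

namespace Costa2019

/-! ### A vanishing-boundary-terms lemma on a half-line -/

/-- If `B` is differentiable on `(a, ∞)` with integrable derivative and `B → 0` at both ends,
then `∫_{(a,∞)} B' = 0`. [folklore] -/
theorem integral_Ioi_eq_zero_of_hasDerivAt_of_tendsto {B B' : ℝ → ℂ} {a : ℝ}
    (hderiv : ∀ r ∈ Ioi a, HasDerivAt B (B' r) r) (hint : IntegrableOn B' (Ioi a))
    (h0 : Tendsto B (𝓝[>] a) (𝓝 0)) (hinf : Tendsto B atTop (𝓝 0)) :
    ∫ r in Ioi a, B' r = 0 := by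
  classical
  set f : ℝ → ℂ := fun r => if a < r then B r else 0 with hf
  have hfa : f a = 0 := by simp [hf]
  have hfeq : ∀ r ∈ Ioi a, f r = B r := fun r hr => by simp [hf, mem_Ioi.1 hr]
  have hcont : ContinuousWithinAt f (Ici a) a := by
    rw [← continuousWithinAt_Ioi_iff_Ici, ContinuousWithinAt, hfa]
    exact h0.congr' (eventually_nhdsWithin_of_forall fun r hr => (hfeq r hr).symm)
  have hderiv' : ∀ r ∈ Ioi a, HasDerivAt f (B' r) r := by
    intro r hr
    have hloc : f =ᶠ[𝓝 r] B := by
      filter_upwards [Ioi_mem_nhds (mem_Ioi.1 hr)] with x hx using hfeq x hx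
    exact (hderiv r hr).congr_of_eventuallyEq hloc
  have hinf' : Tendsto f atTop (𝓝 0) := by
    refine hinf.congr' ?_
    filter_upwards [eventually_gt_atTop a] with r hr using (hfeq r hr).symm
  have h := integral_Ioi_of_hasDerivAt_of_tendsto hcont hderiv' hint hinf'
  rw [h, hfa, sub_zero]

/-! ### The amplitude `Φ = w g = (r−r₋)^η (r−r₊)^ξ e^{γr} R` -/

/-- The amplitude of Whiting's transform for a radial function `R`:
`Φ(r) = (r − r₋)^η (r − r₊)^ξ e^{−iωr} R(r)` (`= w g`, TdC (def-g-tilde-sub), second form).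
[cite: Costa2019, §3.2 (def-g-tilde-sub)] -/
def whitingAmplitude (M a ω m : ℝ) (R : ℝ → ℂ) (r : ℝ) : ℂ :=
  ((r - rMinus M a : ℝ) : ℂ) ^ innerExponent M a ω m *
    ((r - rPlus M a : ℝ) : ℂ) ^ horizonExponent M a ω m * Complex.exp (-(I * ω * r)) * R r

/-- `w · (heunWeight · R) = Φ` on `(r₊, ∞)`. [cite: Costa2019, §3.2 (def-g-tilde-sub)] -/
theorem heunMeasure_mul_g (M a s ω m : ℝ) (R : ℝ → ℂ) {r : ℝ} (hr : rPlus M a < r) :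
    heunMeasure M a s ω m r * (heunWeight M a s ω m r * R r) = whitingAmplitude M a ω m R r := by
  unfold whitingAmplitude
  rw [← mul_assoc, heunMeasure_mul_heunWeight M a s ω m hr]

/-- The prefactor of `Φ` is unimodular: `|(r−r₋)^η (r−r₊)^ξ e^{−iωr}| = 1` (`r > r₊`, real `ω`).
[cite: Costa2019, §3.2] -/
theorem norm_amplitudePrefactor (M a ω m : ℝ) {r : ℝ} (hr : rPlus M a < r) :
    ‖((r - rMinus M a : ℝ) : ℂ) ^ innerExponent M a ω m *
        ((r - rPlus M a : ℝ) : ℂ) ^ horizonExponent M a ω m * Complex.exp (-(I * ω * r))‖ = 1 := by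
  have hq : rMinus M a < r := (rMinus_le_rPlus M a).trans_lt hr
  rw [norm_mul, norm_mul, Complex.norm_cpow_eq_rpow_re_of_pos (sub_pos.2 hq),
    Complex.norm_cpow_eq_rpow_re_of_pos (sub_pos.2 hr), innerExponent_re', horizonExponent_re,
    Real.rpow_zero, Real.rpow_zero, Complex.norm_exp]
  simp [Complex.neg_re, Complex.mul_re, Complex.I_re, Complex.I_im, Complex.ofReal_re,
    Complex.ofReal_im]

/-- `|Φ(r)| = |R(r)|` for `r > r₊`. [cite: Costa2019, §3.2] -/
theorem norm_whitingAmplitude (M a ω m : ℝ) (R : ℝ → ℂ) {r : ℝ} (hr : rPlus M a < r) :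
    ‖whitingAmplitude M a ω m R r‖ = ‖R r‖ := by
  unfold whitingAmplitude
  rw [norm_mul, norm_amplitudePrefactor M a ω m hr, one_mul]

/-- `Φ` is continuous on `(r₊, ∞)` for a classical radial solution. [folklore] -/
theorem continuousOn_whitingAmplitude {M a s ω m lam : ℝ} (ha : |a| ≤ M) {R : ℝ → ℂ}
    (hsol : IsRadialTeukolskySolution M a s ω m lam R) :
    ContinuousOn (whitingAmplitude M a ω m R) (Ioi (rPlus M a)) := by
  have hRc : ContinuousOn R (Ioi (rPlus M a)) :=
    (contDiffOn_of_isRadialTeukolskySolution ha hsol).continuousOn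
  intro r hr
  have hr' : rPlus M a < r := hr
  have hq : rMinus M a < r := (rMinus_le_rPlus M a).trans_lt hr'
  have hA := (hasDerivAt_ofReal_sub_cpow (rMinus M a) (innerExponent M a ω m) hq).continuousAt
  have hB := (hasDerivAt_ofReal_sub_cpow (rPlus M a) (horizonExponent M a ω m) hr').continuousAt
  have hE : ContinuousAt (fun r : ℝ => Complex.exp (-(I * ω * r))) r :=
    (Complex.continuous_exp.comp ((continuous_const.mul Complex.continuous_ofReal).neg)).continuousAt
  exact ((hA.mul hB).mul hE).continuousWithinAt.mul (hRc r hr)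

/-! ### Sizes of the weights -/

/-- `|heunWeight(r)| = (r − r₋)^s (r − r₊)^s` for `r > r₊`. [cite: Costa2019, §3.2 (def-g-sub)] -/
theorem norm_heunWeight (M a s ω m : ℝ) {r : ℝ} (hr : rPlus M a < r) :
    ‖heunWeight M a s ω m r‖ = (r - rMinus M a) ^ s * (r - rPlus M a) ^ s := by
  have hq : rMinus M a < r := (rMinus_le_rPlus M a).trans_lt hr
  unfold heunWeight
  rw [norm_mul, norm_mul, Complex.norm_cpow_eq_rpow_re_of_pos (sub_pos.2 hq),
    Complex.norm_cpow_eq_rpow_re_of_pos (sub_pos.2 hr), Complex.norm_exp]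
  simp [Complex.sub_re, Complex.mul_re, Complex.I_re, Complex.I_im, Complex.ofReal_re,
    Complex.ofReal_im, innerExponent_re', horizonExponent_re]

/-- `|w(r)| = (r − r₋)^{−s} (r − r₊)^{−s}` for `r > r₊`. [cite: Costa2019, Lemma 3.13] -/
theorem norm_heunMeasure (M a s ω m : ℝ) {r : ℝ} (hr : rPlus M a < r) :
    ‖heunMeasure M a s ω m r‖ = (r - rMinus M a) ^ (-s) * (r - rPlus M a) ^ (-s) := by
  have hq : rMinus M a < r := (rMinus_le_rPlus M a).trans_lt hr
  unfold heunMeasure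
  rw [norm_mul, norm_mul, Complex.norm_cpow_eq_rpow_re_of_pos (sub_pos.2 hq),
    Complex.norm_cpow_eq_rpow_re_of_pos (sub_pos.2 hr), Complex.norm_exp]
  simp [Complex.sub_re, Complex.mul_re, Complex.I_re, Complex.I_im, Complex.ofReal_re,
    Complex.ofReal_im, innerExponent_re', horizonExponent_re]

/-- `|ψ(r)| ≤ |s − η| + |s − ξ| + |ω|` for `r ≥ r₊ + 1`. [folklore] -/
theorem norm_heunPsi_le (M a s ω m : ℝ) {r : ℝ} (hr : rPlus M a + 1 ≤ r) :
    ‖heunPsi M a s ω m r‖ ≤ ‖(s : ℂ) - innerExponent M a ω m‖ +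
      ‖(s : ℂ) - horizonExponent M a ω m‖ + |ω| := by
  have h1 : 1 ≤ r - rPlus M a := by linarith
  have h2 : 1 ≤ r - rMinus M a := by linarith [rMinus_le_rPlus M a]
  unfold heunPsi
  refine (norm_add_le _ _).trans (add_le_add ((norm_add_le _ _).trans (add_le_add ?_ ?_)) ?_)
  · rw [norm_div, Complex.norm_real, Real.norm_eq_abs, abs_of_pos (by linarith)]
    exact div_le_self (norm_nonneg _) h2
  · rw [norm_div, Complex.norm_real, Real.norm_eq_abs, abs_of_pos (by linarith)]
    exact div_le_self (norm_nonneg _) h1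
  · rw [norm_mul, Complex.norm_I, Complex.norm_real, Real.norm_eq_abs, one_mul]

/-! ### The boundary form `w Δ (K g' − g K')` vanishes at both ends -/

/-- **At the horizon**: if `K, K'` are bounded on `(r₊, ∞)` and `g, g'` are bounded near `r₊⁺`,
then `w Δ (K g' − g K') → 0` as `r → r₊⁺` (`s ≤ 0`: `|w| Δ = (r−r₋)^{1−s}(r−r₊)^{1−s} → 0`; TdC:
"At the horizon, the extra factor of `(r − r₊)` makes the boundary term vanish").
[cite: Costa2019, Lemma 3.12 (proof)] -/
theorem boundaryForm_tendsto_zero_horizon {M a s : ℝ} (ha : |a| < M) (hs : s ≤ 0) (ω m : ℝ)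
    {K K₁ g g₁ : ℝ → ℂ} {Bk B δ : ℝ} (hδ : 0 < δ)
    (hK : ∀ r, rPlus M a < r → ‖K r‖ ≤ Bk) (hK₁ : ∀ r, rPlus M a < r → ‖K₁ r‖ ≤ Bk)
    (hg : ∀ r ∈ Ioo (rPlus M a) (rPlus M a + δ), ‖g r‖ ≤ B ∧ ‖g₁ r‖ ≤ B) :
    Tendsto (fun r => heunMeasure M a s ω m r * (delta M a r : ℂ) * (K r * g₁ r - g r * K₁ r))
      (𝓝[>] rPlus M a) (𝓝 0) := by
  have hgap : 0 < rPlus M a - rMinus M a := sub_pos.2 (IsSubextremal.rMinus_lt_rPlus ha)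
  set Cg : ℝ := (rPlus M a - rMinus M a + 1) ^ (-s) with hCg
  have hCg0 : 0 ≤ Cg := Real.rpow_nonneg (by linarith) _
  -- `Δ → 0` at `r₊`
  have hΔ : Tendsto (fun r => delta M a r) (𝓝[>] rPlus M a) (𝓝 0) := by
    have hc : Continuous fun r => delta M a r := by
      unfold delta; fun_prop
    have h0 : delta M a (rPlus M a) = 0 := by rw [delta_eq_mul ha.le]; ring
    have := (hc.tendsto (rPlus M a)).mono_left (nhdsWithin_le_nhds (s := Ioi (rPlus M a)))
    rwa [h0] at this
  have hbound : ∀ r ∈ Ioo (rPlus M a) (rPlus M a + min δ 1),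
      ‖heunMeasure M a s ω m r * (delta M a r : ℂ) * (K r * g₁ r - g r * K₁ r)‖ ≤
        Cg * (2 * (|Bk| * |B|)) * delta M a r := by
    intro r hr
    have hr1 : rPlus M a < r := hr.1
    have hrδ : r ∈ Ioo (rPlus M a) (rPlus M a + δ) := ⟨hr.1, lt_of_lt_of_le hr.2 (by
      linarith [min_le_left δ 1])⟩
    have hq : rMinus M a < r := (rMinus_le_rPlus M a).trans_lt hr1
    have hΔ0 : 0 ≤ delta M a r := (delta_pos ha.le hr1).le
    -- the weight
    have hw : ‖heunMeasure M a s ω m r‖ ≤ Cg := by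
      rw [norm_heunMeasure M a s ω m hr1]
      have h1 : (r - rPlus M a) ^ (-s) ≤ 1 :=
        Real.rpow_le_one (sub_pos.2 hr1).le (by linarith [hr.2, min_le_right δ 1]) (by linarith)
      have h2 : (r - rMinus M a) ^ (-s) ≤ Cg :=
        Real.rpow_le_rpow (sub_pos.2 hq).le (by linarith [hr.2, min_le_right δ 1]) (by linarith)
      calc (r - rMinus M a) ^ (-s) * (r - rPlus M a) ^ (-s) ≤ Cg * 1 :=
            mul_le_mul h2 h1 (Real.rpow_nonneg (sub_pos.2 hr1).le _) hCg0
        _ = Cg := mul_one _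
    -- the bracket
    have hbr : ‖K r * g₁ r - g r * K₁ r‖ ≤ 2 * (|Bk| * |B|) := by
      have e1 : ‖K r * g₁ r‖ ≤ |Bk| * |B| := by
        rw [norm_mul]
        exact mul_le_mul ((hK r hr1).trans (le_abs_self _)) ((hg r hrδ).2.trans (le_abs_self _))
          (norm_nonneg _) (abs_nonneg _)
      have e2 : ‖g r * K₁ r‖ ≤ |Bk| * |B| := by
        rw [norm_mul, mul_comm]
        exact mul_le_mul ((hK₁ r hr1).trans (le_abs_self _)) ((hg r hrδ).1.trans (le_abs_self _))
          (norm_nonneg _) (abs_nonneg _)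
      calc ‖K r * g₁ r - g r * K₁ r‖ ≤ ‖K r * g₁ r‖ + ‖g r * K₁ r‖ := norm_sub_le _ _
        _ ≤ _ := by linarith
    rw [norm_mul, norm_mul, Complex.norm_real, Real.norm_eq_abs, abs_of_nonneg hΔ0]
    calc ‖heunMeasure M a s ω m r‖ * delta M a r * ‖K r * g₁ r - g r * K₁ r‖ ≤
        Cg * delta M a r * (2 * (|Bk| * |B|)) := by gcongr
      _ = Cg * (2 * (|Bk| * |B|)) * delta M a r := by ring
  -- squeeze
  refine squeeze_zero_norm' (a := fun r => Cg * (2 * (|Bk| * |B|)) * delta M a r) ?_ ?_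
  · have hmem : Ioo (rPlus M a) (rPlus M a + min δ 1) ∈ 𝓝[>] rPlus M a :=
      Ioo_mem_nhdsGT (by simp [hδ])
    exact eventually_of_mem hmem hbound
  · simpa using hΔ.const_mul (Cg * (2 * (|Bk| * |B|)))

/-- **At infinity**: if `|K|, |K'| ≤ Bk e^{−c(r−r₋)}` (`c > 0`) and `|g|, |g'| ≤ C r^p` for
`r ≥ X` (`X ≥ r₊ + 1`, `X ≥ 1`), then `w Δ (K g' − g K') → 0` as `r → ∞` (`s ≤ 0`).
[cite: Costa2019, Lemma 3.12 (proof: "the exponential decay of `e^{A(x−r₋)(r−r₋)}` as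
`r → ∞` also makes the boundary terms vanish")] -/
theorem boundaryForm_tendsto_zero_atTop {M a s : ℝ} (hM : 0 < M) (ha : |a| < M) (hs : s ≤ 0)
    (ω m : ℝ) {K K₁ g g₁ : ℝ → ℂ} {Bk C p c X : ℝ} (hc : 0 < c)
    (hX : rPlus M a + 1 ≤ X) (hX1 : 1 ≤ X)
    (hK : ∀ r, X ≤ r → ‖K r‖ ≤ Bk * Real.exp (-c * (r - rMinus M a)))
    (hK₁ : ∀ r, X ≤ r → ‖K₁ r‖ ≤ Bk * Real.exp (-c * (r - rMinus M a)))
    (hg : ∀ r, X ≤ r → ‖g r‖ ≤ C * r ^ p) (hg₁ : ∀ r, X ≤ r → ‖g₁ r‖ ≤ C * r ^ p) :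
    Tendsto (fun r => heunMeasure M a s ω m r * (delta M a r : ℂ) * (K r * g₁ r - g r * K₁ r))
      atTop (𝓝 0) := by
  have hrm : 0 ≤ rMinus M a := IsSubextremal.rMinus_nonneg ha
  have hrp : 0 < rPlus M a := rPlus_pos hM a
  -- the comparison function `D r^q e^{−cr}`
  set q : ℝ := -s + -s + 2 + p with hq
  set D : ℝ := (1 + a ^ 2) * (2 * (|Bk| * |C|)) * Real.exp (c * rMinus M a) with hD
  have hD0 : 0 ≤ D := by positivity
  have hlim : Tendsto (fun r : ℝ => D * (r ^ q * Real.exp (-c * r))) atTop (𝓝 0) := by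
    simpa using (tendsto_rpow_mul_exp_neg_mul_atTop_nhds_zero q c hc).const_mul D
  have hbound : ∀ r, X ≤ r →
      ‖heunMeasure M a s ω m r * (delta M a r : ℂ) * (K r * g₁ r - g r * K₁ r)‖ ≤
        D * (r ^ q * Real.exp (-c * r)) := by
    intro r hr
    have hr1 : rPlus M a < r := by linarith
    have hq' : rMinus M a < r := (rMinus_le_rPlus M a).trans_lt hr1
    have hr0 : 0 < r := hrp.trans hr1
    have hrge1 : 1 ≤ r := hX1.trans hr
    have hΔ0 : 0 ≤ delta M a r := (delta_pos ha.le hr1).le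
    -- weight: `(r−r₋)^{−s}(r−r₊)^{−s} ≤ r^{−s} r^{−s}`
    have hw : ‖heunMeasure M a s ω m r‖ ≤ r ^ (-s) * r ^ (-s) := by
      rw [norm_heunMeasure M a s ω m hr1]
      exact mul_le_mul (Real.rpow_le_rpow (sub_pos.2 hq').le (by linarith) (by linarith))
        (Real.rpow_le_rpow (sub_pos.2 hr1).le (by linarith) (by linarith))
        (Real.rpow_nonneg (sub_pos.2 hr1).le _) (Real.rpow_nonneg hr0.le _)
    -- `Δ ≤ (1 + a²) r²`
    have hΔ : delta M a r ≤ (1 + a ^ 2) * r ^ (2 : ℝ) := by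
      rw [Real.rpow_two]
      have h1 : a ^ 2 * 1 ≤ a ^ 2 * r ^ 2 := mul_le_mul_of_nonneg_left (by nlinarith) (sq_nonneg a)
      have h2 : 0 ≤ 2 * M * r := by positivity
      unfold delta; nlinarith
    -- the bracket
    set e : ℝ := Real.exp (-c * (r - rMinus M a)) with he
    have he0 : 0 ≤ e := (Real.exp_pos _).le
    have hbr : ‖K r * g₁ r - g r * K₁ r‖ ≤ 2 * (|Bk| * |C|) * (e * r ^ p) := by
      have hrp0 : 0 ≤ r ^ p := Real.rpow_nonneg hr0.le _
      have e1 : ‖K r * g₁ r‖ ≤ (|Bk| * e) * (|C| * r ^ p) := by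
        rw [norm_mul]
        refine mul_le_mul ((hK r hr).trans ?_) ((hg₁ r hr).trans ?_) (norm_nonneg _)
          (by positivity)
        · exact mul_le_mul_of_nonneg_right (le_abs_self _) he0
        · exact mul_le_mul_of_nonneg_right (le_abs_self _) hrp0
      have e2 : ‖g r * K₁ r‖ ≤ (|C| * r ^ p) * (|Bk| * e) := by
        rw [norm_mul]
        refine mul_le_mul ((hg r hr).trans ?_) ((hK₁ r hr).trans ?_) (norm_nonneg _)
          (by positivity)
        · exact mul_le_mul_of_nonneg_right (le_abs_self _) hrp0
        · exact mul_le_mul_of_nonneg_right (le_abs_self _) he0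
      calc ‖K r * g₁ r - g r * K₁ r‖ ≤ ‖K r * g₁ r‖ + ‖g r * K₁ r‖ := norm_sub_le _ _
        _ ≤ (|Bk| * e) * (|C| * r ^ p) + (|C| * r ^ p) * (|Bk| * e) := add_le_add e1 e2
        _ = 2 * (|Bk| * |C|) * (e * r ^ p) := by ring
    -- assemble: `r^{−s} r^{−s} (1+a²) r² · 2|Bk||C| e r^p = D r^q e^{−cr}`
    have hpow : r ^ (-s) * r ^ (-s) * r ^ (2 : ℝ) * r ^ p = r ^ q := by
      rw [hq, Real.rpow_add hr0, Real.rpow_add hr0, Real.rpow_add hr0]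
    have hexp : e = Real.exp (c * rMinus M a) * Real.exp (-c * r) := by
      rw [he, ← Real.exp_add]; congr 1; ring
    rw [norm_mul, norm_mul, Complex.norm_real, Real.norm_eq_abs, abs_of_nonneg hΔ0]
    calc ‖heunMeasure M a s ω m r‖ * delta M a r * ‖K r * g₁ r - g r * K₁ r‖ ≤
        (r ^ (-s) * r ^ (-s)) * ((1 + a ^ 2) * r ^ (2 : ℝ)) * (2 * (|Bk| * |C|) * (e * r ^ p)) := by
          gcongr
      _ = (1 + a ^ 2) * (2 * (|Bk| * |C|)) * e * (r ^ (-s) * r ^ (-s) * r ^ (2 : ℝ) * r ^ p) := by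
          ring
      _ = D * (r ^ q * Real.exp (-c * r)) := by rw [hpow, hexp, hD]; ring
  refine squeeze_zero_norm' (eventually_atTop.2 ⟨X, hbound⟩) hlim

/-! ### The tilde equation off the real axis -/

/-- **Lemma 3.12 for `y ω > 0`: the transform solves the tilde equation.** Let `|a| < M`,
`s ≤ 0`, `ω ≠ 0` real, and `R` a classical solution of the radial Teukolsky equation which is
outgoing at `𝓗⁺` and at `𝓘⁺`. With `Φ = (r−r₋)^η (r−r₊)^ξ e^{−iωr} R`, `K = e^{A(z−r₋)(r−r₋)}`,
`z = x + iy`, `yω > 0`, the absolutely convergent integrals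
`G_j(z) = ∫_{r₊}^∞ K (A(r−r₋))ʲ Φ dr` satisfy
`(z − r₊)(z − r₋) G₂ + P̃(z) G₁ + Q̃(z) G₀ = 0`.
[cite: Costa2019, Lemma 3.12] -/
theorem whitingTransform_tildeEquation {M a : ℝ} (hM : 0 < M) (ha : |a| < M) {s : ℝ}
    (hs : s ≤ 0) {ω : ℝ} (hω : ω ≠ 0) (m lam : ℝ) {R : ℝ → ℂ}
    (hsol : IsRadialTeukolskySolution M a s ω m lam R) (hH : IsOutgoingAtHorizon M a s ω m R)
    (hI : IsOutgoingAtInfinity M s ω R) {y : ℝ} (hy : 0 < ω * y) (x : ℝ) :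
    (((x : ℂ) + I * y) - rPlus M a) * (((x : ℂ) + I * y) - rMinus M a) *
          (∫ r in Ioi (rPlus M a), whitingKernel M a ω ((x : ℂ) + I * y) r *
            (whitingA M a ω * ((r - rMinus M a : ℝ) : ℂ)) ^ 2 * whitingAmplitude M a ω m R r) +
        heunPt M a s ω m ((x : ℂ) + I * y) *
          (∫ r in Ioi (rPlus M a), whitingKernel M a ω ((x : ℂ) + I * y) r *
            (whitingA M a ω * ((r - rMinus M a : ℝ) : ℂ)) ^ 1 * whitingAmplitude M a ω m R r) +
        heunQt M a s ω m lam ((x : ℂ) + I * y) *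
          (∫ r in Ioi (rPlus M a), whitingKernel M a ω ((x : ℂ) + I * y) r *
            (whitingA M a ω * ((r - rMinus M a : ℝ) : ℂ)) ^ 0 * whitingAmplitude M a ω m R r) =
      0 := by
  set z : ℂ := (x : ℂ) + I * y with hz
  set K : ℝ → ℂ := fun r => whitingKernel M a ω z r with hK
  set Az : ℂ := whitingA M a ω * (z - rMinus M a) with hAz
  set Φ : ℝ → ℂ := whitingAmplitude M a ω m R with hΦ
  set g : ℝ → ℂ := fun r => heunWeight M a s ω m r * R r with hg
  set Sym : ℝ → ℂ := fun r => (z - rPlus M a) * (z - rMinus M a) *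
      (whitingA M a ω * ((r - rMinus M a : ℝ) : ℂ)) ^ 2 +
    heunPt M a s ω m z * (whitingA M a ω * ((r - rMinus M a : ℝ) : ℂ)) +
    heunQt M a s ω m lam z with hSym
  have hgap : 0 < rPlus M a - rMinus M a := sub_pos.2 (IsSubextremal.rMinus_lt_rPlus ha)
  -- derivatives of `g` and the Heun equation; derivative of `R`
  obtain ⟨g₁, g₂, hge⟩ := heunEquation_of_isRadialTeukolskySolution hM ha hsol
  obtain ⟨R', R'', hR⟩ := id hsol
  -- polynomial bound on `R = |Φ|` on `(r₊, ∞)`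
  obtain ⟨C₀, hC₀⟩ := norm_le_mul_pow_of_outgoing ha hs hsol hH hI
  have hΦb : ∀ r, rPlus M a < r → ‖Φ r‖ ≤ C₀ * (1 + r) ^ ⌈-2 * s⌉₊ := fun r hr => by
    rw [hΦ, norm_whitingAmplitude M a ω m R hr]; exact hC₀ r hr
  have hΦc : ContinuousOn Φ (Ioi (rPlus M a)) := continuousOn_whitingAmplitude ha.le hsol
  -- the boundary form and its derivative
  set B : ℝ → ℂ := fun r => heunMeasure M a s ω m r * (delta M a r : ℂ) *
    (K r * g₁ r - g r * (K r * Az)) with hB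
  have hBd : ∀ r ∈ Ioi (rPlus M a), HasDerivAt B (-(Sym r * K r * Φ r)) r := by
    intro r hr
    have hr' : rPlus M a < r := hr
    obtain ⟨hg1, hg2, hge0⟩ := hge r hr'
    have hK1 : HasDerivAt K (K r * Az) r := hasDerivAt_whitingKernel_r M a ω z r
    have hK2 : HasDerivAt (fun r => K r * Az) (K r * Az * Az) r := hK1.mul_const Az
    have hL := lagrange_identity_heun hM ha s ω m lam hr' (f := g) (h := K)
      (h₁ := fun r => K r * Az) (h₂ := fun r => K r * Az * Az) hg1 hg2 hK1 hK2
    refine hL.congr_deriv ?_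
    have e2 := whiting_symbol_identity hM ha s ω m lam z r
    have e3 := heunMeasure_mul_g M a s ω m R hr'
    simp only [hΦ, hSym]
    rw [← e3]
    simp only [hg] at hge0 ⊢
    linear_combination (heunMeasure M a s ω m r * K r) * hge0 -
      (heunMeasure M a s ω m r * (heunWeight M a s ω m r * R r) * K r) * e2
  -- integrability of `B'`
  have hT : ∀ j : ℕ, IntegrableOn (fun r => K r *
      (whitingA M a ω * ((r - rMinus M a : ℝ) : ℂ)) ^ j * Φ r) (Ioi (rPlus M a)) := fun j =>
    integrableOn_whitingKernel_mul hM ha hy x j hΦc hΦb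
  have hB'eq : (fun r => -(Sym r * K r * Φ r)) = fun r =>
      -((z - rPlus M a) * (z - rMinus M a) *
          (K r * (whitingA M a ω * ((r - rMinus M a : ℝ) : ℂ)) ^ 2 * Φ r) +
        heunPt M a s ω m z * (K r * (whitingA M a ω * ((r - rMinus M a : ℝ) : ℂ)) ^ 1 * Φ r) +
        heunQt M a s ω m lam z *
          (K r * (whitingA M a ω * ((r - rMinus M a : ℝ) : ℂ)) ^ 0 * Φ r)) := by
    funext r; simp only [hSym]; ring
  have hB'int : IntegrableOn (fun r => -(Sym r * K r * Φ r)) (Ioi (rPlus M a)) := by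
    rw [hB'eq]
    exact ((((hT 2).const_mul _).add ((hT 1).const_mul _)).add ((hT 0).const_mul _)).neg
  -- the boundary form vanishes at the horizon …
  have hc : 0 < 2 * ω * y / (rPlus M a - rMinus M a) := by
    have : 0 < 2 * ω * y := by nlinarith
    positivity
  have hKn : ∀ r, ‖K r‖ = Real.exp (-(2 * ω * y / (rPlus M a - rMinus M a)) * (r - rMinus M a)) :=
    fun r => by rw [hK]; exact norm_whitingKernel ha ω x y r
  have hKle : ∀ r, rPlus M a < r → ‖K r‖ ≤ max 1 ‖Az‖ := fun r hr =>
    (norm_whitingKernel_le_one ha hy.le x ((rMinus_le_rPlus M a).trans hr.le)).trans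
      (le_max_left _ _)
  have hK₁le : ∀ r, rPlus M a < r → ‖K r * Az‖ ≤ max 1 ‖Az‖ := fun r hr => by
    rw [norm_mul]
    calc ‖K r‖ * ‖Az‖ ≤ 1 * ‖Az‖ := mul_le_mul_of_nonneg_right
          (norm_whitingKernel_le_one ha hy.le x ((rMinus_le_rPlus M a).trans hr.le)) (norm_nonneg _)
      _ ≤ max 1 ‖Az‖ := by rw [one_mul]; exact le_max_right _ _
  obtain ⟨δ, Bg, hδ, hgb⟩ := heunWeight_mul_bounded_near_horizon ha hH (fun r hr => (hge r hr).1)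
  have h0 : Tendsto B (𝓝[>] rPlus M a) (𝓝 0) :=
    boundaryForm_tendsto_zero_horizon ha hs ω m (K₁ := fun r => K r * Az) hδ hKle hK₁le hgb
  -- … and at infinity
  obtain ⟨X, C, p, hX, hX1, hC, hp, hgrow⟩ :=
    exists_rpow_bound_of_isRadialTeukolskySolution hM ha hω hsol fun r hr => (hR r hr).1
  set Cψ : ℝ := ‖(s : ℂ) - innerExponent M a ω m‖ + ‖(s : ℂ) - horizonExponent M a ω m‖ + |ω|
    with hCψ
  have hCψ0 : 0 ≤ Cψ := by positivity
  have hwle : ∀ r, X ≤ r → ‖heunWeight M a s ω m r‖ ≤ 1 := by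
    intro r hr
    have hr1 : rPlus M a < r := by linarith
    rw [norm_heunWeight M a s ω m hr1]
    have h1 : (r - rMinus M a) ^ s ≤ 1 :=
      Real.rpow_le_one_of_one_le_of_nonpos (by linarith [rMinus_le_rPlus M a]) hs
    have h2 : (r - rPlus M a) ^ s ≤ 1 := Real.rpow_le_one_of_one_le_of_nonpos (by linarith) hs
    calc (r - rMinus M a) ^ s * (r - rPlus M a) ^ s ≤ 1 * 1 :=
          mul_le_mul h1 h2 (Real.rpow_nonneg (by linarith) _) zero_le_one
      _ = 1 := one_mul _
  have hgX : ∀ r, X ≤ r → ‖g r‖ ≤ (Cψ + 1) * C * r ^ p := by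
    intro r hr
    have hr0 : 0 < r := by linarith
    have hrp0 : 0 ≤ C * r ^ p := mul_nonneg hC (Real.rpow_nonneg hr0.le _)
    rw [hg, norm_mul]
    calc ‖heunWeight M a s ω m r‖ * ‖R r‖ ≤ 1 * (C * r ^ p) :=
          mul_le_mul (hwle r hr) (hgrow r hr).1 (norm_nonneg _) zero_le_one
      _ ≤ (Cψ + 1) * C * r ^ p := by nlinarith
  have hg₁X : ∀ r, X ≤ r → ‖g₁ r‖ ≤ (Cψ + 1) * C * r ^ p := by
    intro r hr
    have hr1 : rPlus M a < r := by linarith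
    have hr0 : 0 < r := by linarith
    have hrp0 : 0 ≤ C * r ^ p := mul_nonneg hC (Real.rpow_nonneg hr0.le _)
    -- `g₁ = heunWeight (ψ R + R')` by uniqueness of derivatives
    have hd := ((hasDerivAt_heunWeight M a s ω m hr1).mul (hR r hr1).1)
    have heq : g₁ r = heunWeight M a s ω m r * heunPsi M a s ω m r * R r +
        heunWeight M a s ω m r * R' r := (hge r hr1).1.unique hd
    rw [heq]
    have hψ := norm_heunPsi_le M a s ω m (show rPlus M a + 1 ≤ r by linarith)
    calc ‖heunWeight M a s ω m r * heunPsi M a s ω m r * R r + heunWeight M a s ω m r * R' r‖ ≤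
        ‖heunWeight M a s ω m r * heunPsi M a s ω m r * R r‖ + ‖heunWeight M a s ω m r * R' r‖ :=
          norm_add_le _ _
      _ ≤ 1 * Cψ * (C * r ^ p) + 1 * (C * r ^ p) := by
          rw [norm_mul, norm_mul, norm_mul]
          exact add_le_add (mul_le_mul (mul_le_mul (hwle r hr) hψ (norm_nonneg _) zero_le_one)
            (hgrow r hr).1 (norm_nonneg _) (by positivity))
            (mul_le_mul (hwle r hr) (hgrow r hr).2 (norm_nonneg _) zero_le_one)
      _ = (Cψ + 1) * C * r ^ p := by ring
  have hKX : ∀ r, X ≤ r → ‖K r‖ ≤ max 1 ‖Az‖ *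
      Real.exp (-(2 * ω * y / (rPlus M a - rMinus M a)) * (r - rMinus M a)) := fun r _ => by
    rw [hKn r]
    exact le_mul_of_one_le_left (Real.exp_pos _).le (le_max_left _ _)
  have hK₁X : ∀ r, X ≤ r → ‖K r * Az‖ ≤ max 1 ‖Az‖ *
      Real.exp (-(2 * ω * y / (rPlus M a - rMinus M a)) * (r - rMinus M a)) := fun r _ => by
    rw [norm_mul, hKn r, mul_comm]
    exact mul_le_mul_of_nonneg_right (le_max_right _ _) (Real.exp_pos _).le
  have hinf : Tendsto B atTop (𝓝 0) :=
    boundaryForm_tendsto_zero_atTop hM ha hs ω m (K₁ := fun r => K r * Az) hc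
      hX hX1 hKX hK₁X hgX hg₁X
  -- integrate `B'` over `(r₊, ∞)`
  have hzero := integral_Ioi_eq_zero_of_hasDerivAt_of_tendsto hBd hB'int h0 hinf
  rw [hB'eq, integral_neg, neg_eq_zero, integral_add, integral_add, integral_const_mul,
    integral_const_mul, integral_const_mul] at hzero
  · simpa only [hK, hΦ, hz] using hzero
  · exact ((hT 2).const_mul _)
  · exact ((hT 1).const_mul _)
  · exact (((hT 2).const_mul _).add ((hT 1).const_mul _))
  · exact ((hT 0).const_mul _)

end Costa2019

end Literature.Geometry.Lorentzian.Kerr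

end
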